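import Summits.BirchSwinnertonDyer.BirchSwinnertonDyer.Theorems.ManinLocalTwoThreeAtkinLehnerCuspFortyFive
import Summits.BirchSwinnertonDyer.BirchSwinnertonDyer.Theorems.ManinLocalTwoThreeEtaLimitDerivFortyFive
import Summits.BirchSwinnertonDyer.BirchSwinnertonDyer.Theorems.ManinLocalTwoThreePhiAtkinLehnerFortyFive
import HarnessLib

/-!
# The `η`-identities of `X₀(45) → 45a1` EXACTLY — `(2S − 3T)² = 4(T+2)³ − 3(T+2)² − 20`, `T′ = −2πiφ₄₅·(2S − 3T)` — and (S2)₄₅: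
# `Λ(φ₄₅) ⊆ Λ(3/4, 161/8)`, the Néron lattice shape of `45a1 = [1, −1, 0, 0, −5]`

Cell bsd-f2-manin, route `ManinLocalTwoThree` (crux C3 `ManinPrimeToThreeAtNine`, stmt-22968: `3² ∣ 45`), prover seat p2 gen 29; the level-`45`
twin of `…EtaIdentitiesFiftySix`.  Objects: `T = η₁η₅/(η₉η₄₅) = x − 2`, `S = η₃²η₁₅²/(η₉²η₄₅²)` with `2S − 3T = 2y + x` on
`45a1 : y² + xy = x³ − x² − 5` (`…EtaMonomialsFortyFive`), and `φ₄₅ = −3B1 + 3B2 − 3B3 − 8B4 − 2B5 + B7 − B8 + B9 + 2B10`, the newform of EVERY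
`X₀(45)`-datum (`…NewformPinningFortyFive.f_apply_eq_fortyFive`, fact-free).  Both `T` and `S` have their poles at the two cusps `∞` and
`1/9 = W₅∞`; the second cusp is handled by the ATKIN–LEHNER `η`-PERMUTATION device (`…AtkinLehnerEtaFortyFive`: `T∘A₀ = T∘β⁻¹`, `S∘A₀ = S∘β⁻¹`,
`β⁻¹σ = (σ−1)/5`; `…PhiAtkinLehnerFortyFive`: `φ₄₅(A₀σ) = (9σ+1)²/5·φ₄₅(β⁻¹σ)`), the six others by Ligozat (`…AtkinLehnerCuspFortyFive`), so only
`q`-expansions AT `∞` enter ((I1)₄₅ of `…EtaMonomialsFortyFive`, (I2a)₄₅ of `…EtaLimitDerivFortyFive`):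

* §0 the cuspidal Sturm bound at level `45` in weight `2`: `S/q⁶` convergent ⟹ `S = 0` (`⌊2·72/12⌋ + 1 = 13 < 6 + 8`);
* §1 **(I1)₄₅ `(2S − 3T)² = 4(T+2)³ − 3(T+2)² − 20` on `ℍ`** — by WEIGHT ZERO: the difference is a holomorphic `Γ₀(45)`-invariant function
  bounded at every cusp and `→ 0` at `∞`, hence a constant (`ModularForm.eq_const_of_weight_zero`), hence `0`;
* §2 **(I2a)₄₅ `T′ = −2πiφ₄₅·(2S − 3T)` on `ℍ`** — `(2πi)⁻¹T′ + φ₄₅·(2S − 3T)` is a cusp form of weight `2` on `Γ₀(45)` (zero at `1/9` by `W₅`,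
  at the other cusps by Ligozat) with `R/q⁶ → 0`, hence `0` by §0;
* §3 **(S2)₄₅**: with `X = T + 7/4 = x − 1/4`, `(X′)² = (2πiφ₄₅)²(4X³ − (3/4)X − 161/8)`, so `Λ(φ₄₅) ⊆ Λ(L₁)` for the period pair with
  `g₂ = 3/4 = c₄/12`, `g₃ = 161/8 = c₆/216` (`45a1`: `c₄ = 9`, `c₆ = 4347`) — the analytic bridge `periodLattice_le_of_deriv_sq`.

No definition, no named fact, no sorry; nothing here proves C3, Manin's conjecture or BSD. [cite: Ligozat1975, Ch. 3–4]
[cite: CremonaAlgorithms1997, Table 1 (45a1), §2.10] [cite: DiamondShurman2005, §1.2, Thm. 3.5.1]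
-/

set_option autoImplicit false
-- lint-debt: the directory name repeats the summit name (sibling precedent `ManinLocalTwoThreeEtaIdentitiesFiftySix.lean`)
set_option linter.dupNamespace false

noncomputable section

open Complex Filter Topology Set Function Asymptotics
open UpperHalfPlane hiding I
open scoped Real Topology Manifold MatrixGroups ModularForm
open ModularForm CongruenceSubgroup SlashInvariantForm
open Literature.NumberTheory.ModularForms
open Literature.NumberTheory.EllipticCurves Literature.NumberTheory.EllipticCurves.ModularForms

namespace Summit.BirchSwinnertonDyer.BirchSwinnertonDyer.Theorems.ManinLocalTwoThree.EtaIdentitiesFortyFive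

open CuspToolkit AnalyticBridge EtaIdentityReductionThirtySix EtaIdentityReductionFortyEight AtkinLehnerEtaFortyFive
  AtkinLehnerCuspFortyFive LevelFortyFive

/-! ## §0 `3² ∣ 45` and the cuspidal Sturm bound at level `45`, weight `2` -/

/-- `3² ∣ 45`. [folklore] -/
theorem three_sq_dvd_fortyFive : 3 ^ 2 ∣ 45 := ⟨5, by norm_num⟩

/-- `[SL₂(ℤ) : Γ₀(45)] = 72` and `#cusps(Γ₀(45)) = 8` in the currency of the tree's Sturm bound. [cite: DiamondShurman2005, §3.8] -/
theorem sturm_data_45 :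
    Nat.card (𝒮ℒ ⧸ ((Gamma0 45 : Subgroup SL(2, ℤ)) : Subgroup (GL (Fin 2) ℝ)).subgroupOf 𝒮ℒ) = 72 ∧
      Nat.card (CuspOrbits ((Gamma0 45 : Subgroup SL(2, ℤ)) : Subgroup (GL (Fin 2) ℝ))) = 8 := by
  constructor
  · rw [card_quotient_subgroupOf_eq_index]
    have h1 := index_gamma0_eq_gamma0Index_holds 45
    unfold index_gamma0_eq_gamma0Index at h1
    rw [h1, gamma0_data_45.1]
  · have h1 := numCusps_eq_nuInfty_holds 45
    unfold numCusps_eq_nuInfty numCusps at h1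
    rw [h1, gamma0_data_45.2.1]

/-- **Cuspidal Sturm bound at level `45`, weight `2`: `S ∈ S₂(Γ₀(45))` with `S/q⁶` convergent at `i∞` vanishes** (`⌊2·72/12⌋ + 1 = 13 < 6 + 8`).
[cite: DiamondShurman2005, Thm. 3.5.1] -/
theorem cuspForm_two_fortyFive_eq_zero_of_tendsto (S : CuspForm (Gamma0 45) 2) {c : ℂ}
    (h : Tendsto (fun τ : ℍ ↦ S τ / Function.Periodic.qParam 1 (τ : ℂ) ^ 6) atImInfty (𝓝 c)) : S = 0 := by
  have h1 : (fun τ : ℍ ↦ S τ / Function.Periodic.qParam 1 (τ : ℂ) ^ 6) =O[atImInfty] fun _ : ℍ ↦ (1 : ℝ) := h.isBigO_one ℝ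
  have h3 := h1.mul (NewformsFiftySix.qParam_pow_isBigO_exp 6)
  simp only [one_mul] at h3
  have hBigO : (⇑S) =O[atImInfty] fun τ : ℍ ↦ Real.exp (-2 * π * (6 : ℕ) * τ.im) := by
    refine h3.congr' (Filter.Eventually.of_forall fun τ ↦ ?_) EventuallyEq.rfl
    have hq : Function.Periodic.qParam 1 (τ : ℂ) ≠ 0 := Complex.exp_ne_zero _
    show S τ / Function.Periodic.qParam 1 (τ : ℂ) ^ 6 * Function.Periodic.qParam 1 (τ : ℂ) ^ 6 = S τ
    rw [div_mul_cancel₀ _ (pow_ne_zero _ hq)]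
  have h0 := coe_eq_zero_of_isBigO_exp S hBigO (by
    rw [sturm_data_45.1, sturm_data_45.2]
    simp only [Int.reduceMul, Int.reduceToNat, Nat.reduceDiv, Nat.cast_ofNat]
    norm_num)
  exact DFunLike.ext' (h0.trans CuspForm.coe_zero.symm)

/-! ## §1 (I1)₄₅: `(2S − 3T)² = 4(T+2)³ − 3(T+2)² − 20`, exactly, by weight zero -/

/-- **(I1)₄₅: `(2S − 3T)² = 4(T+2)³ − 3(T+2)² − 20` on `ℍ`** (`45a1: y² + xy = x³ − x² − 5` with `x = T + 2`, `2y + x = 2S − 3T`).  The difference is a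
weight-`0` modular form on `Γ₀(45)` (holomorphic, invariant; bounded at the cusps with `9 ∤ c` by Ligozat, at the class of `1/9` by `W₅`, and `→ 0` at `∞` by
(I1)₄₅ as a limit), hence constant, hence `0`. [cite: Ligozat1975, Ch. 3] [cite: CremonaAlgorithms1997, Table 1 (45a1)] -/
theorem cubic45 (τ : ℍ) :
    (2 * etaQuotient 45 (expFn [(3, 2), (9, -2), (15, 2), (45, -2)]) τ - 3 * etaQuotient 45 (expFn [(1, 1), (5, 1), (9, -1), (45, -1)]) τ) ^ 2
    = 4 * (etaQuotient 45 (expFn [(1, 1), (5, 1), (9, -1), (45, -1)]) τ + 2) ^ 3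
      - 3 * (etaQuotient 45 (expFn [(1, 1), (5, 1), (9, -1), (45, -1)]) τ + 2) ^ 2 - 20 := by
  set T : ℍ → ℂ := etaQuotient 45 (expFn [(1, 1), (5, 1), (9, -1), (45, -1)]) with hT
  set S : ℍ → ℂ := etaQuotient 45 (expFn [(3, 2), (9, -2), (15, 2), (45, -2)]) with hS
  set F : ℍ → ℂ := fun σ ↦ (2 * S σ - 3 * T σ) ^ 2 - (4 * (T σ + 2) ^ 3 - 3 * (T σ + 2) ^ 2 - 20) with hF
  have hF0 : Tendsto F atImInfty (𝓝 0) := EtaMonomialsFortyFive.tendsto_I1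
  have hFsmul : ∀ γ : SL(2, ℤ), γ ∈ Gamma0 45 → ∀ σ : ℍ, F (γ • σ) = F σ := fun γ hγ σ ↦ by
    simp only [hF, hT, hS, T_smul γ hγ σ, S_smul γ hγ σ]
  have hslash0 : ∀ γ : SL(2, ℤ), F ∣[(0 : ℤ)] γ = fun σ ↦ F (γ • σ) := fun γ ↦ by
    funext σ
    rw [SL_slash_apply, neg_zero, zpow_zero, mul_one]
  have hFslash : ∀ γ : SL(2, ℤ), γ ∈ Gamma0 45 → F ∣[(0 : ℤ)] γ = F := fun γ hγ ↦ by
    rw [hslash0 γ]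
    funext σ
    exact hFsmul γ hγ σ
  have hTmd : MDifferentiable 𝓘(ℂ) 𝓘(ℂ) T := mdifferentiable_etaQuotient 45 _
  have hSmd : MDifferentiable 𝓘(ℂ) 𝓘(ℂ) S := mdifferentiable_etaQuotient 45 _
  have hFmd : MDifferentiable 𝓘(ℂ) 𝓘(ℂ) F := by
    have hT' := UpperHalfPlane.mdifferentiable_iff.mp hTmd
    have hS' := UpperHalfPlane.mdifferentiable_iff.mp hSmd
    rw [UpperHalfPlane.mdifferentiable_iff]
    have h := (((hS'.const_mul (2 : ℂ)).sub (hT'.const_mul (3 : ℂ))).pow 2).sub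
      (((((hT'.add_const (2 : ℂ)).pow 3).const_mul (4 : ℂ)).sub (((hT'.add_const (2 : ℂ)).pow 2).const_mul (3 : ℂ))).sub_const (20 : ℂ))
    refine h.congr fun z _ ↦ ?_
    simp only [hF, Function.comp_apply, Pi.sub_apply, Pi.pow_apply]
  -- at the class of the cusp `1/9`: `F(A₀σ) = F((σ−1)/5)`
  have hA₀ : ∀ A₀ : SL(2, ℤ), A₀ 0 0 = 1 → A₀ 0 1 = 0 → A₀ 1 0 = 9 → A₀ 1 1 = 1 → IsBoundedAtImInfty (F ∣[(0 : ℤ)] A₀) := by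
    intro A₀ h00 h01 h10 h11
    rw [hslash0 A₀]
    have hfun : (fun σ : ℍ ↦ F (A₀ • σ)) = fun σ : ℍ ↦ F (affPt 1 (-1) 5 one_pos (by norm_num) σ) := by
      funext σ
      simp only [hF, hT, hS, T_A0_smul A₀ h00 h01 h10 h11 σ, S_A0_smul A₀ h00 h01 h10 h11 σ]
    rw [hfun]
    exact isBoundedAtImInfty_comp_affPt (Filter.ZeroAtFilter.boundedAtFilter hF0)
  have hFbdd : ∀ γ : SL(2, ℤ), IsBoundedAtImInfty (F ∣[(0 : ℤ)] γ) := by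
    intro γ
    by_cases hγ : γ ∈ Gamma0 45
    · rw [hFslash γ hγ]
      exact Filter.ZeroAtFilter.boundedAtFilter hF0
    · by_cases h9 : (9 : ℤ) ∣ γ 1 0
      · exact isBoundedAtImInfty_slash_of_cusp_ninth F 0 hFslash hA₀ h9 hγ
      · rw [hslash0 γ]
        have hTb : IsBoundedAtImInfty (fun τ : ℍ ↦ T (γ • τ)) := isBoundedAtImInfty_T_smul h9
        have hSb : IsBoundedAtImInfty (fun τ : ℍ ↦ S (γ • τ)) := isBoundedAtImInfty_S_smul h9
        have hy : IsBoundedAtImInfty (fun τ : ℍ ↦ 2 * S (γ • τ) - 3 * T (γ • τ)) := (hSb.const_mul_left 2).sub (hTb.const_mul_left 3)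
        have hx : IsBoundedAtImInfty (fun τ : ℍ ↦ T (γ • τ) + 2) := hTb.add (const_boundedAtFilter atImInfty (2 : ℂ))
        have hx2 : IsBoundedAtImInfty (fun τ : ℍ ↦ (T (γ • τ) + 2) * (T (γ • τ) + 2)) := hx.mul hx
        have hx3 : IsBoundedAtImInfty (fun τ : ℍ ↦ (T (γ • τ) + 2) * (T (γ • τ) + 2) * (T (γ • τ) + 2)) := hx2.mul hx
        have hsq : IsBoundedAtImInfty (fun τ : ℍ ↦ (2 * S (γ • τ) - 3 * T (γ • τ)) * (2 * S (γ • τ) - 3 * T (γ • τ))) := hy.mul hy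
        exact (hsq.sub (((hx3.const_mul_left 4).sub (hx2.const_mul_left 3)).sub (const_boundedAtFilter atImInfty (20 : ℂ)))).congr_left
          fun σ ↦ by simp only [hF, Function.const_apply]; ring
  let Fm : ModularForm (Gamma0 45) 0 :=
    { toFun := F
      slash_action_eq' := fun A hA ↦ by
        obtain ⟨γ, hγ, rfl⟩ := hA
        exact hFslash γ hγ
      holo' := hFmd
      bdd_at_cusps' := fun {c} hc ↦ by
        rw [Subgroup.IsArithmetic.isCusp_iff_isCusp_SL2Z] at hc
        rw [OnePoint.isBoundedAt_iff_forall_SL2Z hc]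
        intro γ _
        exact hFbdd γ }
  obtain ⟨c, hc⟩ := ModularForm.eq_const_of_weight_zero Fm
  have hc' : F = Function.const ℍ c := hc
  have hc0 : c = 0 := by
    rw [hc'] at hF0
    exact tendsto_const_nhds_iff.mp hF0
  have hFτ : F τ = 0 := by rw [hc', hc0]; rfl
  have h' : (2 * S τ - 3 * T τ) ^ 2 - (4 * (T τ + 2) ^ 3 - 3 * (T τ + 2) ^ 2 - 20) = 0 := hFτ
  linear_combination h'

/-- Non-degeneracy on `X = T + 7/4`: `4X³ − (3/4)X − 161/8 = 4T³ + 21T² + 36T` is not identically `0` (else `(Tq²)³ → 1` and `→ 0`). [folklore] -/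
theorem exists_X_nondegenerate :
    ∃ τ₀ : ℍ, 4 * (etaQuotient 45 (expFn [(1, 1), (5, 1), (9, -1), (45, -1)]) τ₀ + 7 / 4) ^ 3
      - (3 / 4) * (etaQuotient 45 (expFn [(1, 1), (5, 1), (9, -1), (45, -1)]) τ₀ + 7 / 4) - 161 / 8 ≠ 0 := by
  by_contra hne
  push Not at hne
  set T : ℍ → ℂ := etaQuotient 45 (expFn [(1, 1), (5, 1), (9, -1), (45, -1)]) with hT
  have hx3 : ∀ τ : ℍ, T τ ^ 3 = -(21 / 4) * T τ ^ 2 - 9 * T τ := fun τ ↦ by linear_combination (1 / 4 : ℂ) * hne τ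
  have hq := tendsto_qParam_zpow_atImInfty (m := 2) (by norm_num)
  have hTq : Tendsto (fun τ : ℍ ↦ T τ * Function.Periodic.qParam 1 (τ : ℂ) ^ (2 : ℤ)) atImInfty (𝓝 1) := by
    have h := tendsto_etaQuotient_div_qParam_zpow 45 (expFn [(1, 1), (5, 1), (9, -1), (45, -1)]) (-2) (by decide)
    refine h.congr fun τ ↦ ?_
    rw [hT, zpow_neg, div_inv_eq_mul]
  have h1 : Tendsto (fun τ : ℍ ↦ (T τ * Function.Periodic.qParam 1 (τ : ℂ) ^ (2 : ℤ)) ^ 3) atImInfty (𝓝 1) := by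
    simpa using hTq.pow 3
  have h2 : Tendsto (fun τ : ℍ ↦ (T τ * Function.Periodic.qParam 1 (τ : ℂ) ^ (2 : ℤ)) ^ 3) atImInfty (𝓝 0) := by
    have h := (((hTq.pow 2).mul hq).const_mul (-(21 / 4) : ℂ)).sub ((((hTq.const_mul 9).mul hq).mul hq))
    simp only [one_pow, mul_zero, sub_zero] at h
    refine h.congr fun τ ↦ ?_
    rw [mul_pow _ _ 3, hx3]
    ring
  exact one_ne_zero (tendsto_nhds_unique h1 h2)

/-! ## §2 (I2a)₄₅: `T′ = −2πiφ₄₅·(2S − 3T)`, exactly, by the cuspidal Sturm bound -/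

section Phi

variable (φ : CuspForm (Gamma0 45) 2)
  (hφ : ⇑φ = fun τ ↦ -3 * B1 τ + 3 * B2 τ - 3 * B3 τ - 8 * B4 τ - 2 * B5 τ + B7 τ - B8 τ + B9 τ + 2 * B10 τ)
include hφ

/-- `φ₄₅|₂A₀ = φ₄₅∘β⁻¹/5` for `A₀ = (1 0; 9 1)`: the newform `45a` has `W₅`-sign `+1` (fact-free, `phi_A0_smul`). [cite: AtkinLehner1970, Thm. 3] -/
theorem phi_slash_A0 (A₀ : SL(2, ℤ)) (h00 : A₀ 0 0 = 1) (h01 : A₀ 0 1 = 0) (h10 : A₀ 1 0 = 9) (h11 : A₀ 1 1 = 1) (σ : ℍ) :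
    (⇑φ ∣[(2 : ℤ)] A₀) σ = (1 / 5 : ℂ) * φ (affPt 1 (-1) 5 one_pos (by norm_num) σ) := by
  have hj := nine_mul_add_one_ne_zero σ
  have h10' : ((A₀ 1 0 : ℤ) : ℂ) = 9 := by exact_mod_cast h10
  have h11' : ((A₀ 1 1 : ℤ) : ℂ) = 1 := by exact_mod_cast h11
  rw [SL_slash_apply, ModularGroup.denom_apply, phi_A0_smul (⇑φ) hφ A₀ h00 h01 h10 h11 σ, h10', h11', zpow_neg, zpow_ofNat]
  field_simp

/-- **`R|₂A → 0` at every `A ∉ Γ₀(45)`** for `R = (2πi)⁻¹T′ + φ₄₅·(2S − 3T)`, once `R → 0` at `∞`: at the cusps with `9 ∤ c` by Ligozat, at the class of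
`1/9` because `R|₂A₀ = R∘β⁻¹/5` (`T`, `S` are `W₅`-invariant and `φ₄₅|W₅ = φ₄₅`). [cite: DiamondShurman2005, §1.2, §3.8] -/
theorem isZeroAtImInfty_slash_R (h0 : IsZeroAtImInfty (fun σ : ℍ ↦ (2 * π * I)⁻¹
      * deriv (etaQuotient 45 (expFn [(1, 1), (5, 1), (9, -1), (45, -1)]) ∘ ofComplex) σ
      + φ σ * (2 * etaQuotient 45 (expFn [(3, 2), (9, -2), (15, 2), (45, -2)]) σ
        - 3 * etaQuotient 45 (expFn [(1, 1), (5, 1), (9, -1), (45, -1)]) σ)))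
    (A : SL(2, ℤ)) (hA : A ∉ Gamma0 45) :
    IsZeroAtImInfty ((fun σ : ℍ ↦ (2 * π * I)⁻¹
      * deriv (etaQuotient 45 (expFn [(1, 1), (5, 1), (9, -1), (45, -1)]) ∘ ofComplex) σ
      + φ σ * (2 * etaQuotient 45 (expFn [(3, 2), (9, -2), (15, 2), (45, -2)]) σ
        - 3 * etaQuotient 45 (expFn [(1, 1), (5, 1), (9, -1), (45, -1)]) σ)) ∣[(2 : ℤ)] A) := by
  set T : ℍ → ℂ := etaQuotient 45 (expFn [(1, 1), (5, 1), (9, -1), (45, -1)]) with hT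
  set S : ℍ → ℂ := etaQuotient 45 (expFn [(3, 2), (9, -2), (15, 2), (45, -2)]) with hS
  have hTmd : MDifferentiable 𝓘(ℂ) 𝓘(ℂ) T := mdifferentiable_etaQuotient 45 _
  have hyinv : ∀ γ : SL(2, ℤ), γ ∈ Gamma0 45 → ∀ τ : ℍ, (fun σ ↦ 2 * S σ - 3 * T σ) (γ • τ) = (fun σ ↦ 2 * S σ - 3 * T σ) τ :=
    fun γ hγ τ ↦ by simp only [hT, hS, T_smul γ hγ τ, S_smul γ hγ τ]
  by_cases h9 : (9 : ℤ) ∣ A 1 0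
  · refine isZeroAtImInfty_slash_of_cusp_ninth _ 2 (fun γ hγ ↦ slash_eq_self_of_mem φ T _ hTmd T_smul hyinv hγ) ?_ h9 hA
    intro A₀ h00 h01 h10 h11
    have hfun : ((fun σ : ℍ ↦ (2 * π * I)⁻¹ * deriv (T ∘ ofComplex) σ + φ σ * (2 * S σ - 3 * T σ)) ∣[(2 : ℤ)] A₀)
        = fun σ : ℍ ↦ (1 / 5 : ℂ) * ((2 * π * I)⁻¹ * deriv (T ∘ ofComplex) (affPt 1 (-1) 5 one_pos (by norm_num) σ)
          + φ (affPt 1 (-1) 5 one_pos (by norm_num) σ) * (2 * S (affPt 1 (-1) 5 one_pos (by norm_num) σ)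
            - 3 * T (affPt 1 (-1) 5 one_pos (by norm_num) σ))) := by
      funext σ
      rw [slash_two_apply_of φ _ hTmd A₀ σ, phi_slash_A0 φ hφ A₀ h00 h01 h10 h11 σ,
        show (fun s : ℍ ↦ T (A₀ • s)) = fun s : ℍ ↦ T (affPt 1 (-1) 5 one_pos (by norm_num) s) from funext (T_A0_smul A₀ h00 h01 h10 h11),
        deriv_comp_affPt hTmd σ, hT, hS, T_A0_smul A₀ h00 h01 h10 h11 σ, S_A0_smul A₀ h00 h01 h10 h11 σ]
      ring
    rw [hfun]
    have h1 := (isZeroAtImInfty_comp_affPt h0).const_mul (1 / 5 : ℂ)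
    rw [mul_zero] at h1
    exact h1
  · exact isZeroAtImInfty_slash_of_isBoundedAtImInfty φ T _ hTmd A (isBoundedAtImInfty_T_smul h9)
      ((((isBoundedAtImInfty_S_smul h9).const_mul_left 2).sub ((isBoundedAtImInfty_T_smul h9).const_mul_left 3)).congr_left fun σ ↦ by
        simp only [hT, hS])

/-- **(I2a)₄₅: `T′ = −2πiφ₄₅·(2S − 3T)` on `ℍ`** (`x′ = −2πiφ₄₅·(2y + x)` on `45a1`). [cite: Ligozat1975, Ch. 4] -/
theorem deriv_T45_identity (τ : ℍ) :
    deriv (etaQuotient 45 (expFn [(1, 1), (5, 1), (9, -1), (45, -1)]) ∘ ofComplex) τ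
      = -(2 * π * I * φ τ) * (2 * etaQuotient 45 (expFn [(3, 2), (9, -2), (15, 2), (45, -2)]) τ
        - 3 * etaQuotient 45 (expFn [(1, 1), (5, 1), (9, -1), (45, -1)]) τ) := by
  have hT1 : Tendsto (fun τ : ℍ ↦ ((2 * π * I)⁻¹
      * deriv (etaQuotient 45 (expFn [(1, 1), (5, 1), (9, -1), (45, -1)]) ∘ ofComplex) τ
      + φ τ * (2 * etaQuotient 45 (expFn [(3, 2), (9, -2), (15, 2), (45, -2)]) τ
        - 3 * etaQuotient 45 (expFn [(1, 1), (5, 1), (9, -1), (45, -1)]) τ))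
      / Function.Periodic.qParam 1 (τ : ℂ) ^ 6) atImInfty (𝓝 0) := by
    simpa only [hφ] using EtaLimitDerivFortyFive.tendsto_I2a
  have hq : Tendsto (fun τ : ℍ ↦ Function.Periodic.qParam 1 (τ : ℂ) ^ 6) atImInfty (𝓝 0) := by
    simpa only [zpow_natCast] using tendsto_qParam_zpow_atImInfty (m := ((6 : ℕ) : ℤ)) (by norm_num)
  have h0 := hT1.mul hq
  rw [zero_mul] at h0
  refine deriv_eq_of_tendsto_pow_of φ 6 (by norm_num) (fun S hS ↦ cuspForm_two_fortyFive_eq_zero_of_tendsto S hS) _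
    (fun σ ↦ 2 * etaQuotient 45 (expFn [(3, 2), (9, -2), (15, 2), (45, -2)]) σ
      - 3 * etaQuotient 45 (expFn [(1, 1), (5, 1), (9, -1), (45, -1)]) σ)
    (mdifferentiable_etaQuotient 45 _)
    (((mdifferentiable_etaQuotient 45 _).const_smul (2 : ℂ)).sub ((mdifferentiable_etaQuotient 45 _).const_smul (3 : ℂ)))
    T_smul (fun γ hγ τ ↦ by simp only [T_smul γ hγ τ, S_smul γ hγ τ])
    (isZeroAtImInfty_slash_R φ hφ (h0.congr fun τ ↦ div_mul_cancel₀ _ (pow_ne_zero _ (Complex.exp_ne_zero _)))) hT1 τ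

/-! ## §3 (S2)₄₅: `Λ(φ₄₅) ⊆ Λ(3/4, 161/8)` -/

/-- **(S2)₄₅**: the period lattice of `φ₄₅` (any nonzero cusp form with this underlying function — every `X₀(45)`-datum's `D.f`) lies in the lattice
of the Weierstrass pair with `g₂ = 3/4 = c₄/12`, `g₃ = 161/8 = c₆/216` of `45a1 = [1, −1, 0, 0, −5]` (analytic bridge on `X = T + 7/4`:
`(X′)² = (2πiφ₄₅)²(4X³ − (3/4)X − 161/8)`). [cite: CremonaAlgorithms1997, §2.10, Table 1 (45a1)] [cite: Manin1972, Prop. 1.4] -/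
theorem periodLatticeLe_fortyFive (hne : φ ≠ 0) :
    ∃ L₁ : PeriodPair, L₁.g₂ = 3 / 4 ∧ L₁.g₃ = 161 / 8 ∧ ∀ z ∈ periodLattice φ, z ∈ L₁.lattice := by
  obtain ⟨L₁, hg2, hg3⟩ := PeriodPair.uniformization_holds (3 / 4 : ℂ) (161 / 8 : ℂ) (by norm_num)
  have hmd : MDifferentiable 𝓘(ℂ) 𝓘(ℂ) (fun τ : ℍ ↦ etaQuotient 45 (expFn [(1, 1), (5, 1), (9, -1), (45, -1)]) τ + 7 / 4) :=
    (mdifferentiable_etaQuotient 45 _).add mdifferentiable_const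
  refine ⟨L₁, hg2, hg3, periodLattice_le_of_deriv_sq φ hne L₁ _ hmd
    (fun γ τ ↦ by simp only [T_smul γ γ.2 τ]) ?_ (by rw [hg2, hg3]; exact exists_X_nondegenerate)⟩
  intro τ
  have hderiv : deriv ((fun σ : ℍ ↦ etaQuotient 45 (expFn [(1, 1), (5, 1), (9, -1), (45, -1)]) σ + 7 / 4) ∘ ofComplex) τ
      = deriv (etaQuotient 45 (expFn [(1, 1), (5, 1), (9, -1), (45, -1)]) ∘ ofComplex) τ := by
    rw [show ((fun σ : ℍ ↦ etaQuotient 45 (expFn [(1, 1), (5, 1), (9, -1), (45, -1)]) σ + 7 / 4) ∘ ofComplex)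
      = fun z ↦ (etaQuotient 45 (expFn [(1, 1), (5, 1), (9, -1), (45, -1)]) ∘ ofComplex) z + 7 / 4 from rfl, deriv_add_const]
  rw [hderiv, deriv_T45_identity φ hφ τ, hg2, hg3]
  linear_combination (2 * π * I * φ τ) ^ 2 * cubic45 τ

end Phi

end Summit.BirchSwinnertonDyer.BirchSwinnertonDyer.Theorems.ManinLocalTwoThree.EtaIdentitiesFortyFive

end
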